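import Summits.BirchSwinnertonDyer.BirchSwinnertonDyer.Theorems.UniversalToricDescentSigmaLocalSurjective
import HarnessLib

/-!
# Route UniversalToricDescent — the local image at a finitely decomposed place, COUNTED:
# `Sel_𝔭^{Σ∪{v}}(K_∞, E[p^∞]) / Sel_𝔭^Σ ≅ H¹(K_{∞,w₀}, E[p^∞])^{p^c}`, so
# `#(Sel^{Σ∪{v}}/Sel^Σ)[p] = (#H¹(K_{∞,w₀}, E[p^∞])[p])^{p^c}` (the algebraic `Σ`-Euler factor at `v`)

Lead prover bsd-wall-utd-p1 g8 (`--supports stmt-BirchSwinnertonDyer-20399`; memo ALG-HALF-21845-STATUS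
§3 (d)). Companion of `UniversalToricDescentSigmaLocalSurjective` (GV Cor. (2.3) over `K_∞`: the signature
map is onto the right-`H`-invariant, left-`D_v`-equivariant functions `Γ_K → H¹(H ∩ D_v, E[p^∞])`):

* §1 `forall_resKerD_conjH1_eq_zero_iff_mem_selmerAc` — KERNEL: for `s ∈ Sel_𝔭^{Σ∪{v}}` (`v ∤ p`,
  `v ∉ Σ`) the signature vanishes iff `s ∈ Sel_𝔭^Σ` (the away condition at `v` for every conjugate).
* §2 `exists_mem_selmerAc_insert_forall_resKerD_conjH1_eq_of_noPTorsionPadic` — the route's instance of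
  the surjectivity (`E/ℚ`, `K` imaginary quadratic with `p` split, (iv) `E(ℚ_p)[p] = 0`, degree-one `𝔭`,
  base finiteness at `v ∣ p`, Poitou–Tate ×2 — the inputs of `surjective_conjSelmerAc_sub_one_of_noPTorsionPadic`).
* §3 **`natCard_quotient_pTorsion_eq_pow`** — with the EXACT index `κ(D_v) = p^c ℤ_p` (`p^c` = number of
  places of `K_∞` above `v`) and representatives `γ^i`, `i < p^c`: the map
  `s ↦ (res_{H∩D_v}(conj_{γ^i} s))_{i<p^c}` is a surjection `Sel^{Σ∪{v}} ↠ H¹(H ∩ D_v, E[p^∞])^{p^c}` with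
  kernel `Sel^Σ`, hence `Sel^{Σ∪{v}}/Sel^Σ ≃+ H¹(H ∩ D_v, E[p^∞])^{p^c}` and
  `#(Sel^{Σ∪{v}}/Sel^Σ)[p] = (#H¹(H ∩ D_v, E[p^∞])[p])^{p^c}` (`Nat.card`; Greenberg–Vatsal (2.10):
  `λ(X^{Σ∪{v}}) − λ(X^Σ) = p^c · corank H¹(K_{∞,w₀}, E[p^∞])`, the algebraic Euler factor at `v`).

HONEST STATUS: helper theorems, CONDITIONAL on the cited Poitou–Tate fact(s) like every (L10)-descendant;
they turn the finite group `B^Σ[p] = (Sel^Σ/Sel^∅)[p]` isolated by `UniversalToricDescentSigmaFreeTransport`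
into local terms one place at a time; the product over `Σ` (needs `p`-divisibility of the intermediate
`Sel^{Σ′}`, available from (N1)^{Σ′} p581291), the identification of `#H¹(K_{∞,w₀}, E[p^∞])[p]` with an
Euler-factor value, the analytic half and 20395 remain. THEOREMS ONLY; no definition, no named fact, no
`sorry`. BSD is not advanced by this file.
References: [GreenbergVatsal2000] §2 Cor. (2.3), Prop. (2.4), (2.10) (pp. 24–28);
[JetchevSkinnerWan2017] Prop. 3.3.2, Lemma 3.3.3 (arXiv:1512.06894 pp. 11–12); [Castella2018] Def. 2.2
(arXiv:1704.06608 p. 5); [MilneADT2006] I 4.10.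
-/

set_option autoImplicit false
-- `…BirchSwinnertonDyer.BirchSwinnertonDyer.Theorems…` is the problem's mandated namespace (D-0017).
set_option linter.dupNamespace false

noncomputable section

open scoped Classical

namespace Summit.BirchSwinnertonDyer.BirchSwinnertonDyer.Theorems.UniversalToricDescentSigmaLocalImage

open CategoryTheory Function Field NumberField IsDedekindDomain WeierstrassCurve
open Literature.NumberTheory.GaloisRepresentations Literature.NumberTheory.EllipticCurves
  Literature.NumberTheory.EllipticCurves.GreenbergSelmer Literature.NumberTheory.GaloisCohomology
  Literature.NumberTheory.EllipticCurves.Rank1Residual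
  Summit.BirchSwinnertonDyer.Rank1Residual Summit.BirchSwinnertonDyer.Rank1Residual.X11b
  Summit.BirchSwinnertonDyer.Rank1Residual.X11b.Coinv Summit.BirchSwinnertonDyer.Rank1Residual.X11b.LocBridge
  Summit.BirchSwinnertonDyer.Rank1Residual.X11b.AcSelmer Summit.BirchSwinnertonDyer.Rank1Residual.X11b.H2Support
  Summit.BirchSwinnertonDyer.Rank1Residual.X11b.Levels
  Summit.BirchSwinnertonDyer.BirchSwinnertonDyer.Theorems.UniversalToricDescentSigmaCoinvariants
  Summit.BirchSwinnertonDyer.BirchSwinnertonDyer.Theorems.UniversalToricDescentSigmaLocalStabilizer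
open Summit.BirchSwinnertonDyer.Rank1Residual.X11b.ProcyclicDescent (kerK)

variable {K : Type} [Field K] [NumberField K] (W : WeierstrassCurve K) [W.IsElliptic] (p : ℕ)
  [Fact p.Prime] (κ : ZpExtension K p)

/-! ### §1 The kernel of the signature map on `Sel_𝔭^{Σ∪{v}}` is `Sel_𝔭^Σ` -/

omit [W.IsElliptic] in
/-- **Kernel.** For `s ∈ Sel_𝔭^{Σ ∪ {v}}(K_∞, E[p^∞])` with `v ∤ p`: the signature
`σ ↦ res_{H ∩ D_v}(conj_σ s)` vanishes identically iff `s ∈ Sel_𝔭^Σ` (the away condition at `v` for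
every conjugate IS the vanishing of the signature, `mem_awayKer_iff_resKerD_eq_zero`).
[cite: Castella2018, Def. 2.2 (arXiv:1704.06608 p. 5)] [cite: GreenbergVatsal2000, §2 Cor. (2.3)] -/
theorem forall_resKerD_conjH1_eq_zero_iff_mem_selmerAc {𝔭 : HeightOneSpectrum (𝓞 K)}
    {S : Set (HeightOneSpectrum (𝓞 K))} {v : HeightOneSpectrum (𝓞 K)}
    (hpv : ((p : ℕ) : 𝓞 K) ∉ v.asIdeal) (hvS : v ∉ S) {s : W.subgroupH1 p κ.kerSubgroup}
    (hs : s ∈ selmerAc W p κ 𝔭 (insert v S)) :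
    (∀ σ : absoluteGaloisGroup K,
        resKerD κ (W.geomPrimaryTorsion p) v (W.conjH1 p κ.kerSubgroup σ s) = 0) ↔
      s ∈ selmerAc W p κ 𝔭 S := by
  have hs' := (mem_selmerOver_iff _).mp hs
  constructor
  · intro h0
    rw [selmerAc, mem_selmerOver_iff]
    refine ⟨fun w hpw hwS σ ↦ ?_, hs'.2.1, hs'.2.2⟩
    by_cases hwv : w = v
    · subst hwv
      exact (mem_awayKer_iff_resKerD_eq_zero κ w _).2 (h0 σ)
    · exact hs'.1 w hpw (fun h ↦ by
        rcases Set.mem_insert_iff.mp h with h | h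
        · exact hwv h
        · exact hwS h) σ
  · intro hS σ
    exact resKerD_eq_zero_of_mem_selmerAc (Or.inl ⟨hpv, hvS⟩) (conjH1_mem_selmerAc σ hS)

/-! ### §2 The route's instance: `E/ℚ` over an imaginary quadratic `K` with `p` split, (iv), base finiteness -/

/-- **`loc_v` onto over `K_∞` at an additive datum.** For `E/ℚ`, `K` imaginary quadratic with `p`
split, (iv) `E(ℚ_p)[p] = 0`, a `ℤ_p`-extension `κ` of `K` with topological generator `γ`, a degree-one
`𝔭 ∋ p`, `Sel_v(K, E[p^∞])` finite at every `v ∣ p`, ANY `Σ` and a place `v ∤ p` finitely decomposed in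
`K_∞`: every right-`ker κ`-invariant, left-`D_v`-equivariant `F : Γ_K → H¹(H ∩ D_v, E[p^∞])` is the
signature of a class of `Sel_𝔭^{Σ∪{v}}(K_∞, E[p^∞])`, GIVEN the two cited Poitou–Tate facts (weak Leopoldt
`H²(K, E[p^∞]) = 0` from `WeakLeopoldt.subsingleton_galoisCohomology_two_primary`, then §2) — exactly the
inputs of the tree's `surjective_conjSelmerAc_sub_one_of_noPTorsionPadic`.
[cite: GreenbergVatsal2000, §2 Cor. (2.3) (p. 25)] [cite: JetchevSkinnerWan2017, Prop. 3.3.2 and Lemma 3.3.3 (arXiv:1512.06894 pp. 11–12)]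
[cite: MilneADT2006, Ch. I, Thm. 4.10 and Thm. 2.8] -/
theorem exists_mem_selmerAc_insert_forall_resKerD_conjH1_eq_of_noPTorsionPadic
    (W : WeierstrassCurve ℚ) [W.IsElliptic] [W.IsGloballyMinimal] (p : ℕ) [Fact p.Prime]
    {K : Type} [Field K] [NumberField K]
    (h4 : ∀ R : (W.baseChange ℚ_[p]).toAffine.Point, p • R = 0 → R = 0)
    (hPT : poitouTate_selmerStructure_duality K) (hPT2 : poitouTate_sha_tateDual K)
    (hK : IsImaginaryQuadratic K) (hsplit : SplitsIn K p)
    (κ : ZpExtension K p) {γ : absoluteGaloisGroup K} (hγ : κ.IsTopGenerator γ)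
    {𝔭 : HeightOneSpectrum (𝓞 K)} (h𝔭 : ((p : ℕ) : 𝓞 K) ∈ 𝔭.asIdeal)
    (he : 𝔭.asIdeal.ramificationIdx (𝓞 ℚ) = 1) (hf : 𝔭.asIdeal.inertiaDeg (𝓞 ℚ) = 1)
    (hfin : ∀ v : HeightOneSpectrum (𝓞 K), ((p : ℕ) : 𝓞 K) ∈ v.asIdeal →
      Finite (selmerAcBase (W.baseChange K) p v ∅))
    (S : Set (HeightOneSpectrum (𝓞 K))) {v : HeightOneSpectrum (𝓞 K)}
    (hpv : ((p : ℕ) : 𝓞 K) ∉ v.asIdeal) (hv : ¬ (decomp v ≤ κ.kerSubgroup))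
    (F : absoluteGaloisGroup K → subgroupH1 (kerD κ v) ((W.baseChange K).geomPrimaryTorsion p))
    (hFH : ∀ (σ h : absoluteGaloisGroup K), h ∈ κ.kerSubgroup → F (σ * h) = F σ)
    (hFD : ∀ (d : decomp (K := K) v) (σ : absoluteGaloisGroup K),
      F ((d : absoluteGaloisGroup K) * σ) =
        conjH1 (kerD κ v) ((W.baseChange K).geomPrimaryTorsion p) d (F σ)) :
    ∃ s ∈ selmerAc (W.baseChange K) p κ 𝔭 (insert v S), ∀ σ : absoluteGaloisGroup K,
      resKerD κ ((W.baseChange K).geomPrimaryTorsion p) v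
        ((W.baseChange K).conjH1 p κ.kerSubgroup σ s) = F σ := by
  haveI : IsTotallyComplex K := hK.2
  obtain ⟨σ, 𝔮, -, hne, h𝔮, -⟩ :=
    LocalIndexTransport.exists_conj_prime_of_splitsIn K p hK.1 hsplit h𝔭
  have hΓ𝔭 := noInvariantsAt_of_noPTorsion W p h4 K κ 𝔭 h𝔭 he hf
  have hΓ := Coinv.noInvariants_of_noInvariants_at (W.baseChange K) p hΓ𝔭
  have htor := exists_pow_nsmul_local_eq_zero W p hK.1 hsplit
  haveI := hfin 𝔭 h𝔭
  have h2 := WeakLeopoldt.subsingleton_galoisCohomology_two_primary (W.baseChange K) p 𝔭 ∅ hPT2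
    (fieldCdLE_two_of_isTotallyComplex fieldCdLE_two_of_numberField_holds K p) hΓ htor
  exact exists_mem_selmerAc_insert_forall_resKerD_conjH1_eq (W.baseChange K) p κ hPT
    (fun v ↦ GaloisImage.EP.localEulerPoincareCharacteristic_adicCompletion K v) h𝔭 h𝔮 hne hΓ𝔭
    (hfin 𝔮 h𝔮) h2 hγ S hpv hv F hFH hFD

/-! ### §3 The count: `Sel^{Σ∪{v}}/Sel^Σ ≅ H¹(H ∩ D_v, E[p^∞])^{p^c}` -/

/-- **`Sel_𝔭^{Σ∪{v}}(K_∞, E[p^∞]) / Sel_𝔭^Σ ≅ H¹(H ∩ D_v, E[p^∞])^{p^c}` and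
`#(Sel^{Σ∪{v}}/Sel^Σ)[p] = (#H¹(H ∩ D_v, E[p^∞])[p])^{p^c}`** (`Nat.card`), for `v ∤ p`, `v ∉ Σ`, with the
exact index `κ(D_v) = p^c ℤ_p` (every `p^c z` is a value on `D_v` and `p^c` divides every value) and the
hypotheses of the surjectivity theorem. The evaluation `s ↦ (res_{H∩D_v}(conj_{γ^i} s))_{i<p^c}` is onto
(a tuple `(f_i)` extends to the equivariant function `d γ^i h ↦ conj_d f_i`, well defined because the
cosets `D_v γ^i H`, `i < p^c`, are distinct and `H ∩ D_v` acts trivially) with kernel `Sel^Σ` (§1 after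
`Γ_K = D_v γ^{<p^c} H`). [cite: GreenbergVatsal2000, §2 Cor. (2.3), Prop. (2.4) and (2.10) (pp. 24–28)]
[cite: Castella2018, Def. 2.2 (arXiv:1704.06608 p. 5)] -/
theorem natCard_quotient_pTorsion_eq_pow [IsTotallyComplex K]
    (hPT : poitouTate_selmerStructure_duality K)
    (hEP : ∀ v : HeightOneSpectrum (𝓞 K), localEulerPoincareCharacteristic (v.adicCompletion K))
    {𝔭 𝔮 : HeightOneSpectrum (𝓞 K)} (h𝔭 : ((p : ℕ) : 𝓞 K) ∈ 𝔭.asIdeal)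
    (h𝔮 : ((p : ℕ) : 𝓞 K) ∈ 𝔮.asIdeal) (hne : 𝔮 ≠ 𝔭)
    (hΓ𝔭 : ∀ Q : W.geomPrimaryTorsion p,
      (∀ σ : absoluteGaloisGroup (𝔭.adicCompletion K),
        GaloisRep.restrictField (𝔭.adicCompletion K) (primaryGaloisModule W p) σ Q = Q) → Q = 0)
    (hfin : Finite (selmerAcBase W p 𝔮 ∅))
    (h2 : Subsingleton (galoisCohomology (primaryGaloisModule W p) 2))
    {γ : absoluteGaloisGroup K} (hγ : κ.IsTopGenerator γ) {S : Set (HeightOneSpectrum (𝓞 K))}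
    {v : HeightOneSpectrum (𝓞 K)} (hpv : ((p : ℕ) : 𝓞 K) ∉ v.asIdeal) (hvS : v ∉ S) {c : ℕ}
    (hc : ∀ z : ℤ_[p], ∃ d : decomp (K := K) v,
      (κ (d : absoluteGaloisGroup K)).toAdd = (p : ℤ_[p]) ^ c * z)
    (hle : ∀ d : decomp (K := K) v, (p : ℤ_[p]) ^ c ∣ (κ (d : absoluteGaloisGroup K)).toAdd) :
    Nonempty ((selmerAc W p κ 𝔭 (insert v S) ⧸
        (selmerAc W p κ 𝔭 S).addSubgroupOf (selmerAc W p κ 𝔭 (insert v S))) ≃+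
        (Fin (p ^ c) → subgroupH1 (kerD κ v) (W.geomPrimaryTorsion p))) ∧
      Nat.card {b : selmerAc W p κ 𝔭 (insert v S) ⧸
          (selmerAc W p κ 𝔭 S).addSubgroupOf (selmerAc W p κ 𝔭 (insert v S)) // p • b = 0} =
        Nat.card {f : subgroupH1 (kerD κ v) (W.geomPrimaryTorsion p) // p • f = 0} ^ (p ^ c) := by
  set H := κ.kerSubgroup with hH
  -- `v` is finitely decomposed: `κ d₁ = p^c ≠ 0`
  have hv : ¬ (decomp v ≤ H) := by
    obtain ⟨d₁, hd₁⟩ := hc 1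
    intro hle'
    have h1 : κ (d₁ : absoluteGaloisGroup K) = 1 := (ZpExtension.mem_kerSubgroup).mp (hle' d₁.2)
    rw [h1, toAdd_one, mul_one] at hd₁
    exact (pow_ne_zero c (Nat.cast_ne_zero.mpr (Fact.out : p.Prime).ne_zero)) hd₁.symm
  -- the evaluation map
  let Ψ : selmerAc W p κ 𝔭 (insert v S) →+ (Fin (p ^ c) → subgroupH1 (kerD κ v) (W.geomPrimaryTorsion p)) :=
    { toFun := fun s i ↦ resKerD κ (W.geomPrimaryTorsion p) v (W.conjH1 p H (γ ^ (i : ℕ)) s)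
      map_zero' := funext fun i ↦ by simp
      map_add' := fun a b ↦ funext fun i ↦ by simp }
  have hΨapply : ∀ (s : selmerAc W p κ 𝔭 (insert v S)) (i : Fin (p ^ c)),
      Ψ s i = resKerD κ (W.geomPrimaryTorsion p) v (W.conjH1 p H (γ ^ (i : ℕ)) s) := fun _ _ ↦ rfl
  -- signatures are right-`H`-invariant and left-`D_v`-equivariant
  have hsig : ∀ (x : W.subgroupH1 p H) (d : decomp (K := K) v) (σ h : absoluteGaloisGroup K), h ∈ H →
      resKerD κ (W.geomPrimaryTorsion p) v (W.conjH1 p H ((d : absoluteGaloisGroup K) * σ * h) x) =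
        conjH1 (kerD κ v) (W.geomPrimaryTorsion p) d
          (resKerD κ (W.geomPrimaryTorsion p) v (W.conjH1 p H σ x)) := by
    intro x d σ h hh
    rw [W.conjH1_mul_holds p H, AddMonoidHom.comp_apply, W.conjH1_of_mem_holds p H hh,
      AddMonoidHom.id_apply, W.conjH1_mul_holds p H, AddMonoidHom.comp_apply, resKerD_conjH1]
  -- (i) the kernel of `Ψ` is `Sel^Σ`
  have hker : Ψ.ker = (selmerAc W p κ 𝔭 S).addSubgroupOf (selmerAc W p κ 𝔭 (insert v S)) := by
    ext s
    rw [AddMonoidHom.mem_ker, AddSubgroup.mem_addSubgroupOf,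
      ← forall_resKerD_conjH1_eq_zero_iff_mem_selmerAc W p κ hpv hvS s.2]
    constructor
    · intro h0 σ
      obtain ⟨d, n, h, hn, hh, rfl⟩ := exists_decomp_mul_pow_lt_mul_mem_ker κ hγ v hc σ
      rw [hsig _ d _ h hh, ← hΨapply s ⟨n, hn⟩, h0, Pi.zero_apply, map_zero]
    · intro h0
      funext i
      rw [hΨapply, h0, Pi.zero_apply]
  -- (ii) `Ψ` is onto
  have hsurj : Function.Surjective Ψ := by
    intro f
    -- the decomposition `σ = d(σ) γ^{n(σ)} h(σ)`
    choose dσ nσ hσ hnσ hhσ heσ using exists_decomp_mul_pow_lt_mul_mem_ker κ hγ v hc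
    -- `conj_d` only depends on `d` modulo `H ∩ D_v`
    have hconj : ∀ (d d' : decomp (K := K) v) (x : subgroupH1 (kerD κ v) (W.geomPrimaryTorsion p)),
        ((d⁻¹ * d' : decomp (K := K) v) : absoluteGaloisGroup K) ∈ H →
        conjH1 (kerD κ v) (W.geomPrimaryTorsion p) d' x =
          conjH1 (kerD κ v) (W.geomPrimaryTorsion p) d x := by
      intro d d' x hmem
      conv_lhs => rw [← mul_inv_cancel_left d d', conjH1_mul_holds (kerD κ v),
        AddMonoidHom.comp_apply, conjH1_of_mem_holds (kerD κ v) _ ((mem_kerD_iff κ v _).2 hmem),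
        AddMonoidHom.id_apply]
    -- uniqueness of the decomposition
    have huniq : ∀ (d d' : decomp (K := K) v) (i j : ℕ) (h h' : absoluteGaloisGroup K),
        i < p ^ c → j < p ^ c → h ∈ H → h' ∈ H →
        (d : absoluteGaloisGroup K) * γ ^ i * h = (d' : absoluteGaloisGroup K) * γ ^ j * h' →
        i = j ∧ ((d'⁻¹ * d : decomp (K := K) v) : absoluteGaloisGroup K) ∈ H := by
      intro d d' i j h h' hi hj hh hh' e
      have hij := eq_of_decomp_mul_pow_mul_eq κ hγ v hle hi hj hh hh' e
      subst hij
      refine ⟨rfl, ?_⟩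
      have e' : ((d'⁻¹ * d : decomp (K := K) v) : absoluteGaloisGroup K) =
          γ ^ i * (h' * h⁻¹) * (γ ^ i)⁻¹ := by
        have e2 : (d : absoluteGaloisGroup K) =
            (d' : absoluteGaloisGroup K) * γ ^ i * h' * h⁻¹ * (γ ^ i)⁻¹ := by
          rw [← e]; group
        rw [Subgroup.coe_mul, Subgroup.coe_inv, e2]
        group
      rw [e']
      exact Subgroup.Normal.conj_mem inferInstance _ (H.mul_mem hh' (H.inv_mem hh)) _
    let F : absoluteGaloisGroup K → subgroupH1 (kerD κ v) (W.geomPrimaryTorsion p) :=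
      fun σ ↦ conjH1 (kerD κ v) (W.geomPrimaryTorsion p) (dσ σ) (f ⟨nσ σ, hnσ σ⟩)
    have hFapply : ∀ σ, F σ = conjH1 (kerD κ v) (W.geomPrimaryTorsion p) (dσ σ) (f ⟨nσ σ, hnσ σ⟩) :=
      fun _ ↦ rfl
    -- `F(d γ^i h) = conj_d (f i)`
    have hFval : ∀ (d : decomp (K := K) v) (i : ℕ) (hi : i < p ^ c) (h : absoluteGaloisGroup K),
        h ∈ H → F ((d : absoluteGaloisGroup K) * γ ^ i * h) =
          conjH1 (kerD κ v) (W.geomPrimaryTorsion p) d (f ⟨i, hi⟩) := by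
      intro d i hi h hh
      set σ := (d : absoluteGaloisGroup K) * γ ^ i * h with hσdef
      obtain ⟨hij, hmem⟩ := huniq d (dσ σ) i (nσ σ) h (hσ σ) hi (hnσ σ) hh (hhσ σ) (heσ σ)
      rw [hFapply, hconj d (dσ σ) _ ?_]
      · congr 2
        exact Fin.ext hij.symm
      · -- `d⁻¹ dσ ∈ H` from `(dσ)⁻¹ d ∈ H`
        have := H.inv_mem hmem
        rwa [← Subgroup.coe_inv, mul_inv_rev, inv_inv] at this
    have hFH : ∀ (σ h : absoluteGaloisGroup K), h ∈ H → F (σ * h) = F σ := by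
      intro σ h hh
      conv_lhs => rw [heσ σ, mul_assoc, hFval (dσ σ) (nσ σ) (hnσ σ) _ (H.mul_mem (hhσ σ) hh)]
    have hFD : ∀ (d : decomp (K := K) v) (σ : absoluteGaloisGroup K),
        F ((d : absoluteGaloisGroup K) * σ) =
          conjH1 (kerD κ v) (W.geomPrimaryTorsion p) d (F σ) := by
      intro d σ
      conv_lhs => rw [heσ σ, ← mul_assoc, ← mul_assoc, ← Subgroup.coe_mul,
        hFval (d * dσ σ) (nσ σ) (hnσ σ) _ (hhσ σ)]
      rw [conjH1_mul_holds (kerD κ v), AddMonoidHom.comp_apply, hFapply]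
    obtain ⟨s, hs, hsF⟩ := exists_mem_selmerAc_insert_forall_resKerD_conjH1_eq W p κ hPT hEP h𝔭 h𝔮
      hne hΓ𝔭 hfin h2 hγ S hpv hv F hFH hFD
    refine ⟨⟨s, hs⟩, funext fun i ↦ ?_⟩
    obtain ⟨i, hi⟩ := i
    rw [hΨapply]
    change resKerD κ (W.geomPrimaryTorsion p) v (W.conjH1 p H (γ ^ i) s) = f ⟨i, hi⟩
    rw [hsF, show γ ^ i = ((1 : decomp (K := K) v) : absoluteGaloisGroup K) * γ ^ i * 1 by
      rw [Subgroup.coe_one, one_mul, mul_one], hFval 1 i hi 1 H.one_mem,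
      Literature.NumberTheory.EllipticCurves.conjH1_one_holds (kerD κ v), AddMonoidHom.id_apply]
  -- (iii) the isomorphism and the count
  let e : (selmerAc W p κ 𝔭 (insert v S) ⧸
      (selmerAc W p κ 𝔭 S).addSubgroupOf (selmerAc W p κ 𝔭 (insert v S))) ≃+
      (Fin (p ^ c) → subgroupH1 (kerD κ v) (W.geomPrimaryTorsion p)) :=
    (QuotientAddGroup.quotientAddEquivOfEq hker.symm).trans
      (QuotientAddGroup.quotientKerEquivOfSurjective Ψ hsurj)
  refine ⟨⟨e⟩, ?_⟩
  have h1 : Nat.card {b : selmerAc W p κ 𝔭 (insert v S) ⧸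
      (selmerAc W p κ 𝔭 S).addSubgroupOf (selmerAc W p κ 𝔭 (insert v S)) // p • b = 0} =
      Nat.card {g : Fin (p ^ c) → subgroupH1 (kerD κ v) (W.geomPrimaryTorsion p) // p • g = 0} := by
    refine Nat.card_congr (Equiv.subtypeEquiv e.toEquiv fun b ↦ ?_)
    show p • b = 0 ↔ p • e b = 0
    rw [← map_nsmul, ← e.map_zero]
    exact e.injective.eq_iff.symm
  have h2' : Nat.card {g : Fin (p ^ c) → subgroupH1 (kerD κ v) (W.geomPrimaryTorsion p) // p • g = 0} =
      Nat.card (Fin (p ^ c) → {f : subgroupH1 (kerD κ v) (W.geomPrimaryTorsion p) // p • f = 0}) := by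
    refine Nat.card_congr
      { toFun := fun g i ↦ ⟨g.1 i, congrFun g.2 i⟩
        invFun := fun g ↦ ⟨fun i ↦ (g i).1, funext fun i ↦ (g i).2⟩
        left_inv := fun g ↦ rfl
        right_inv := fun g ↦ rfl }
  rw [h1, h2', Nat.card_fun, Nat.card_fin]

end Summit.BirchSwinnertonDyer.BirchSwinnertonDyer.Theorems.UniversalToricDescentSigmaLocalImage

end
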